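import Mathlib
import Literature.MathematicalPhysics.QuantumFieldTheory.Balaban1983to89.B6QGQCoerciveTowerTorus

/-!
# `Balaban1983to89.B6Ineq288OneScaleTorus` — T. Bałaban, *Propagators and renormalization transformations for lattice gauge
theories. II*, Commun. Math. Phys. **96** (1984) 223–250 [Balaban1984PropagatorsII], p. 238: **THE BOUND (2.88) FOR THE GENUINE KERNEL
OF `∂P∂*`, `P = G′Q′*(Q′G′²Q′*)⁻¹Q′G′` OF (2.17), ON THE ONE-SCALE TOWER-TORUS FAMILY — the census edge
`B6Ineq288Edge.ineq288_of_printed` (Prop. 2.2 ∧ Prop. 2.3 ∧ Lemma 2.1 ⟹ (2.88)) FIRED WITH EVERY HYPOTHESIS DISCHARGED**, including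
the reader's identification *"λ = Q′\*δ_{y₁}"* of the outer kernels, which the edge carries as a hypothesis; and the operator `R = I − P`
of (2.17) proved to be THE orthogonal projection onto `Δ′_aN(Q′)` (p. 225) for the genuine operators of the family

statement-level skeleton of published theorems with citation tags; proofs where landed; nothing here is a claim about the Yang–Mills mass gap.
PDF held: `paper:balaban1984-cmp96-propagators-rt-ii` (journal page = PDF page + 222); pp. 225–226 [PDF 3–4] and p. 238 [PDF 16] read
this session from the ×2 page renders `b2b-balaban-ref1/pages/1984-cmp96-propagators-rt-II/1984-cmp96-propagators-rt-II-p003-x2.png`,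
`…-p004-x2.png`, `…-p016-x2.png` AS IMAGES (the OCR text layer of these pages is unusable for the displays).

CITATION HEADER (cell `lit-balaban`, Phase-2 proof seat `p01` (gen 7) = unit `lit-balaban-p01`, HOME `run/shared/lean/pub/lit-balaban/`,
`PHASE2-TARGETS.md` §G, free-target protocol G.5-34(d), own lineage: the gen-6 files `…B6Prop22OneScaleTorus` (p258648),
`…B6Lemma21TowerTorus` (p260319), `…B6Ineq268OneScaleTorus` (p260915), `…B6QGGQInvTowerTorus` (p261936), `…B6QGQCoerciveTowerTorus`
(p263803) put Lemma 2.1 ∧ Proposition 2.2 ∧ Proposition 2.3 — the three verbatim census Props of `…B6` — on ONE family with GENUINE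
operators and no hypothesis; the closing `example` of the last file instantiated the edge `B6Ineq288Edge.ineq288_of_printed_lemma21`, whose
conclusion still quantifies over ABSTRACT outer kernels `K₁, K₃` "read through" entries of (2.67)).  SKELETON row **`B6.Eq2.88`** (head
`proved-existing`, implication kind; owner r03; this file = MODEL INSTANCE per G.1: the printed (2.88) for the kernel the sentence is ABOUT).
Imported, not modified: `…B6QGQCoerciveTowerTorus` and through it the whole lineage (`B1RG242Torus.tower`/`Qk`/`Qks`/`deriv` — Bałaban's
concrete scalar block-averaging tower on the tori `Site P j`; `B6QGGQInvTowerTorus.qggqK`/`cinvK`/`deltaPrimeK`; `B6Ineq288Edge`;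
`B6Cor28.Ineq288`/`comp3`).

WHAT THE PAPER PRINTS.  p. 225 [PDF 3]: *"let R be an orthogonal projection in the space L²(T_η) onto the subspace ΔN(Q′)"* …
*"Rf = Δλ = Δ′_aλ = f − G′Q′\*(Q′G′²Q′\*)⁻¹Q′G′f. (2.17)"*; p. 226 [PDF 4]: *"Δ_a = ∂\*∂ + ∂R∂\* + Q\*aQ = Δ − ∂P∂\* + Q\*aQ, (2.19)"*;
p. 238 [PDF 16], verbatim: *"Finally let us consider the kernel of the operator ∂P∂\* appearing in ∂R∂\*, R = I − P given by (2.18). We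
have from Lemma 2.1, Proposition 2.2 and (2.87), |(∂P∂\*)_{μν}(x, x′)| = |(∂_μG′Q′\*(Q′G′²Q′\*)⁻¹Q′G′∂\*_ν)(x, x′)| ≤ O(1) Σ_{y₁,y₂∈𝔅}
L^jη e^{−½δ₀d(y,y₁)}(L^{j₁}η)^{−4}e^{−½δ₁d(y₁,y₂)}(L^{j₂}η)^{−d} · e^{−½δ₀d(y₂,y′)}L^{j′}η ≤ O(1)(L^jη)^{−2}(L^{j′}η)^{−d}e^{−δ₂d(y,y′)}, (2.88)
where x ∈ B^j(y), x′ ∈ B^{j′}(y′), y ∈ Λ_j, y′ ∈ Λ_{j′}, and δ₂ is determined by δ₀, δ₁. The choice of factors is again arbitrary and may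
be changed into any other admissible choice."*  Kernel convention of the paper (p. 249 (2.150), verbatim): *"(HB)(b) = Σ_{c∈𝔅}(L^{j(c)}η)^d
H(b, c)B(c)"* — on the η-lattice `T_η` an operator `A` has the kernel `A(x, x′)` with `(Af)(x) = Σ_{x′} η^d A(x, x′)f(x′)`, i.e. `η^{−d}`
times its matrix entry; on the unit lattice `𝔅 = T₁^{(K)}` (one scale, `(L^jη)^d = 1`) the kernel IS the matrix entry.

THE READING (one scale; the family of `…B6Prop22OneScaleTorus`: volume `P = (d, L, m, K)`, `K ≥ 1`, fine torus `T_η = Site P 0`, `η = L^{−K}`,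
unit lattice `𝔅 = Λ_K = T₁^{(K)} = Site P K`, every site at scale `K`, `L^jη = 1`, `d(y, y′) = T1` the periodic ℓ¹ distance, `x ∈ B^K(y)` ↔
`blk P K x = y`; `G′ = (B1RG242Torus.tower P a m²).G K = Δ′⁻¹`, `Δ′ = −Δ^η + m² + a_KQ′_K\*Q′_K` (`deltaPrimeK`), `Q′ = Q_K` (`Qk`: block
AVERAGE, matrix entry `η^d·[x ∈ B(y)]`), `Q′* = Q_K*` (`Qks`: block-constant extension, entry `[x ∈ B(y)]`), `(Q′G′²Q′*)⁻¹ = (qggqK)⁻¹`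
(`cinvK`), `∂_μ = ∂^η_μ` (`B1RG242Torus.deriv P 0 η μ`, forward), `∂*_ν = ∂_νᵀ` (the η-pairing has equal weights on sites, so the adjoint is
the transpose; the lineage's declared convention).  Hence `P := G′·Q′*·(Q′G′²Q′*)⁻¹·Q′·G′` (`pOp`) and the printed kernel
`(∂P∂*)_{μν}(x, x′) = η^{−d}·(∂_μ·P·∂_νᵀ)(x, x′)` (`dPdKer`).

WHAT IS PROVED HERE (0 sorry, 0 new named facts; axioms standard).
§1 `pOp`, `rOp` (`R = I − P`); **`pOp_mul_pOp`** (P² = P), **`pOp_transpose`** (P symmetric, hence self-adjoint for the η-pairing),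
  `rOp_mul_rOp`, `rOp_transpose`, **`Qk_lamOf`/`rOp_mulVec_eq`** (`Rf = Δ′λ` with `Q′λ = 0` — the printed `Rf = Δλ = Δ′_aλ`, λ explicit as in
  the line before (2.17): `λ = G′f − G′²Q′*(Q′G′²Q′*)⁻¹Q′G′f`), **`rOp_mulVec_deltaPrime_of_ker`** (`R(Δ′λ) = Δ′λ` for `λ ∈ N(Q′)`): so `R` IS
  the orthogonal projection onto `Δ′N(Q′_K)` and (2.17) holds for the genuine operators (`Qk_G_rOp`: `Q′G′R = 0`, the second equation
  of (2.16)).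
§2 the kernel: `colB y₁ = 1_{B^K(y₁)} = Q′*δ_{y₁}` (`Qks_apply`), `dG μ = ∂_μG′`, `dPd μ ν = ∂_μP∂_νᵀ`, `dPdKer` (the printed kernel),
  `dPd_mulVec` (the (2.150) convention: `(∂_μP∂*_νf)(x) = Σ_{x′}η^d·dPdKer(x,x′)f(x′)`), the outer kernels `K1 μ x`, `K3 ν x′` and
  **`dPdKer_eq_comp3`**: `(∂P∂*)_{μν}(x, x′) = Σ_{y₁,y₂∈𝔅}(∂_μG′Q′*)(x, y₁)(Q′G′²Q′*)⁻¹(y₁, y₂)(Q′G′∂*_ν)(y₂, x′)` — the printed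
  factorisation, EXACT (`Q_K = η^d·Q_K*ᵀ`, `G′` symmetric).
§3 the READING DISCHARGED: `lamB y₁` (all components `1_{B^K(y₁)}`), `lamB_supp` (supp ⊂ B^K(y₁)), `supNormV_lamB_le` (`|λ| ≤ 1 = c_Q`),
  **`abs_K1_le`/`abs_K3_le`**: the outer kernels ARE dominated by entry 1 (`∇G′`, prefactor `L^jη`) of the genuine (2.67)-family `torusGp`
  — the hypotheses `hsupp`, `hnorm`, `hval₁`, `hval₃` of `B6Ineq288Edge.ineq288_of_printed` hold for the genuine kernels.
§4 **`ineq288_read_towerTorus`**: the census decl `B6Cor28.Ineq288` INHABITED for the genuine kernels `(K1 μ x, (Q′G′²Q′*)⁻¹, K3 ν x′)` on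
  every member with `R ≥ 1`, `Mb ≥ M₂` (uniform `C, δ₂ > 0`), by `B6Ineq288Edge.ineq288_of_printed` BY NAME fed with
  `prop22Printed_oneScaleTorus`, `prop23Printed_towerTorus`, the §3 reading, (2.54) `triangle254_oneScaleGeo`, (2.60)/(2.61)
  `ineq260_oneScaleGeo`/`ineq261_oneScaleGeo`, and the three largeness conditions `L⁴, L^d, L ≤ e^{αδRM}` EXHIBITED (`rpow_le_exp_of_mul_log_le`,
  `RM ≥ M ≥ 2(d+4)log L/δ`); **`ineq288_towerTorus`** — THE PRINTED (2.88) FOR THE GENUINE KERNEL: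
  `|(∂P∂*)_{μν}(x, x′)| ≤ C·e^{−δ₂d(y,y′)}`, `x ∈ B^K(y)`, `x′ ∈ B^K(y′)`, all `μ, ν`, every volume, every `K ≥ 1` (η → 0), every such member;
  `towerTorus_meets_thresholds` (non-vacuity: members with any prescribed `m, K` and `R ≥ 1`, `Mb ≥ M₂` exist).
ROUTE ∕ HONEST SCOPE.  (i) ONE scale only (one zone, `(L^jη)^{−2}(L^{j′}η)^{−d} = 1`, (2.1)–(2.2) void): the multi-scale (2.88) — levels
`j ≠ j′`, the metric (2.46) across levels — is the DAG hypothesis of the cell and is NOT touched; on one scale the statement coincides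
in content with [4] (1.126) (*"|(∂P∂\*)_{μ,ν}(x, x′)| ≤ O(1)e^{−δ′₀|x−x′|}"*, [Balaban1984PropagatorsI] p. 38), which the cell proved in the
FOURIER presentation on different carriers (`B5Kernel126TorusInstance.kernel126_127Printed_torus`, seat r02); THIS file is [B6]'s own
route — the composition (2.88) of Prop. 2.2, Prop. 2.3 and Lemma 2.1 — for the matrix presentation on the tower carriers, with the decay in
the block distance `d(y, y′)` as printed.  (ii) Scalar model (`U = 1`), `m² ≥ 0` and `a > 0` as parameters of the family (the paper: `m² = 0`,
`a = 1`); constants existential, uniform in the volume, in `K ≥ 1`, `Mb`, `R`.  (iii) The thresholds `Mb ≥ M₂`, `R ≥ 1` come from the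
EDGE as typed (its witnesses `M₂` for Props 2.2/2.3 and the scale-transfer largeness `L⁴, L^d, L ≤ e^{αδRM}` of `B6Cor28.transfer_of_260`,
vacuous in content on one scale but demanded by the abstract statement); they are the print's *"M sufficiently large"* ∕ (2.59).
(iv) The identification `(∂P∂*)_{μν} = ∂_μG′Q′*(Q′G′²Q′*)⁻¹Q′G′∂*_ν` is definitional here (`P` is DEFINED by (2.17)); what is PROVED
is that `I − P` is the orthogonal projection onto `Δ′N(Q′)` named on p. 225, i.e. that this `P` is the paper's.  (iv′) The GENERIC-constant
edge `B6Ineq288Edge.ineq288_of_printed` is used rather than its `…_of_printed_lemma21` variant: the latter fixes the Lemma-2.1 rate `δ`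
BEFORE the witnesses `δ₀, δ₁` of Props 2.2/2.3 are produced, whereas the compatible rate `δ = min(δ₀, δ₁)/4` must be chosen after them;
on this family Lemma 2.1 holds verbatim at every rate (`B6Lemma21TowerTorus.lemma21Printed_towerTorus`) and exactly its (2.60)/(2.61)
content at that rate, with the PRINTED constant `c₁(δ, ½) = 12c₀(¼)^d`, is what enters (`ineq260_oneScaleGeo`, `ineq261_oneScaleGeo`).  (v) Hölder companions
((1.127) of [4]) are not part of (2.88) and are not treated.  Value = the census edge of row B6.Eq2.88 made non-vacuous with every
hypothesis discharged on a genuine model; NOT the multi-scale statement, NOT summit progress.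
-/

namespace Literature.MathematicalPhysics.QuantumFieldTheory.Balaban1983to89.B6Ineq288OneScaleTorus

open Finset Matrix
open B1RG242Torus (tower Qk Qks hOp avgMat extMat lvl QkQks lvl_of_le deriv)
open B6QGGQInvTowerTorus (wQ wQ_pos Qk_eq_smul_transpose deltaPrimeK deltaPrimeK_transpose deltaPrimeK_isUnit G_eq_inv
  G_transpose deltaPrimeK_mul_G G_mul_deltaPrimeK qggqK qggqK_transpose qggqK_isUnit cinvK cinvK_mul mul_cinvK)
open B6QGQCoerciveTowerTorus (prop23Printed_towerTorus)
open B6Prop22OneScaleTorus (T1 oneScaleGeo torusGp Index prop22Printed_oneScaleTorus blockSup le_blockSup entryB entryB_one_top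
  oneScaleGeo_len)
open B6Lemma21TowerTorus (T1_nonneg triangle254_oneScaleGeo dist_symm_oneScaleGeo ineq260_oneScaleGeo ineq261_oneScaleGeo)
open B5Ineq137Torus (blk fine supN)
open B5GpSettingTorus (dir0 supNormV)
open B6Cor28 (Ineq288 comp3)
open B6RandomWalk (Ineq260 Triangle254)
open B6Lemma21Repaired (Ineq261With)

noncomputable section

variable (P : Params)

/-! ### Matrix algebra of `G′Q′*(Q′G′²Q′*)⁻¹Q′G′` (generic bookkeeping) -/

section Algebra

variable {m n : Type*} [Fintype m] [Fintype n]

/-- `(GSCQG)² = GSCQG` when `C(QG²S) = 1`. [folklore] -/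
private theorem gscqg_idem [DecidableEq m] (G : Matrix n n ℝ) (S : Matrix n m ℝ) (C : Matrix m m ℝ) (Q : Matrix m n ℝ)
    (h : C * (Q * G * G * S) = 1) : G * S * C * Q * G * (G * S * C * Q * G) = G * S * C * Q * G := by
  calc G * S * C * Q * G * (G * S * C * Q * G) = G * S * (C * (Q * G * G * S)) * C * Q * G := by
        simp only [Matrix.mul_assoc]
    _ = G * S * C * Q * G := by rw [h, Matrix.mul_one]

/-- `Q(G²SCQG) = QG` when `(QG²S)C = 1`. [folklore] -/
private theorem q_ggscqg [DecidableEq m] (G : Matrix n n ℝ) (S : Matrix n m ℝ) (C : Matrix m m ℝ) (Q : Matrix m n ℝ)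
    (h : Q * G * G * S * C = 1) : Q * (G * G * S * C * Q * G) = Q * G := by
  calc Q * (G * G * S * C * Q * G) = (Q * G * G * S * C) * (Q * G) := by simp only [Matrix.mul_assoc]
    _ = Q * G := by rw [h, Matrix.one_mul]

/-- `QG(GSCQG) = QG` when `(QG²S)C = 1`. [folklore] -/
private theorem qg_gscqg [DecidableEq m] (G : Matrix n n ℝ) (S : Matrix n m ℝ) (C : Matrix m m ℝ) (Q : Matrix m n ℝ)
    (h : Q * G * G * S * C = 1) : Q * G * (G * S * C * Q * G) = Q * G := by
  calc Q * G * (G * S * C * Q * G) = (Q * G * G * S * C) * (Q * G) := by simp only [Matrix.mul_assoc]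
    _ = Q * G := by rw [h, Matrix.one_mul]

/-- `D(G²SCQG) = GSCQG` when `DG = 1`. [folklore] -/
private theorem d_ggscqg [DecidableEq n] (D G : Matrix n n ℝ) (S : Matrix n m ℝ) (C : Matrix m m ℝ) (Q : Matrix m n ℝ)
    (h : D * G = 1) : D * (G * G * S * C * Q * G) = G * S * C * Q * G := by
  calc D * (G * G * S * C * Q * G) = (D * G) * (G * S * C * Q * G) := by simp only [Matrix.mul_assoc]
    _ = G * S * C * Q * G := by rw [h, Matrix.one_mul]

/-- `(GSCQG)D = GSCQ` when `GD = 1`. [folklore] -/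
private theorem gscqg_d [DecidableEq n] (D G : Matrix n n ℝ) (S : Matrix n m ℝ) (C : Matrix m m ℝ) (Q : Matrix m n ℝ)
    (h : G * D = 1) : G * S * C * Q * G * D = G * S * C * Q := by
  calc G * S * C * Q * G * D = G * S * C * Q * (G * D) := by simp only [Matrix.mul_assoc]
    _ = G * S * C * Q := by rw [h, Matrix.mul_one]

/-- `(GSCQG)ᵀ = GSCQG` when `Gᵀ = G`, `Cᵀ = C`, `Qᵀ = wS`, `Sᵀ = w⁻¹Q`. [folklore] -/
private theorem gscqg_transpose (G : Matrix n n ℝ) (S : Matrix n m ℝ) (C : Matrix m m ℝ) (Q : Matrix m n ℝ) {w : ℝ}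
    (hw : w ≠ 0) (hG : Gᵀ = G) (hC : Cᵀ = C) (hQ : Qᵀ = w • S) (hS : Sᵀ = w⁻¹ • Q) :
    (G * S * C * Q * G)ᵀ = G * S * C * Q * G := by
  simp only [Matrix.transpose_mul, hG, hC, hQ, hS, Matrix.smul_mul, Matrix.mul_smul, smul_smul,
    inv_mul_cancel₀ hw, one_smul, Matrix.mul_assoc]

end Algebra

/-! ## §1. `P = G′Q′*(Q′G′²Q′*)⁻¹Q′G′` of (2.17) and `R = I − P`, the orthogonal projection onto `Δ′N(Q′)` -/

/-- **`P := G′Q′*(Q′G′²Q′*)⁻¹Q′G′`** on the fine torus `T_η = Site P 0` — the operator of (2.17) (`R = I − P`, *"R = I − P given by (2.18)"*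
on p. 238), with `G′ = G′_K = (tower P a m²).G K`, `Q′ = Q_K`, `Q′* = Q_K*`, `(Q′G′²Q′*)⁻¹ = (qggqK)⁻¹`.
[cite: Balaban1984PropagatorsII, (2.17) p.225; (2.88) p.238] -/
def pOp (a msq : ℝ) : Matrix (Site P 0) (Site P 0) ℝ :=
  (tower P a msq).G P.K * Qks P P.K * (qggqK P a msq)⁻¹ * Qk P P.K * (tower P a msq).G P.K

/-- **`R := I − P`** (2.17), the operator called *"an orthogonal projection in the space L²(T_η) onto the subspace ΔN(Q′)"* on p. 225.
[cite: Balaban1984PropagatorsII, (2.17) p.225] -/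
def rOp (a msq : ℝ) : Matrix (Site P 0) (Site P 0) ℝ := 1 - pOp P a msq

/-- **`P² = P`** (`Q′G′·G′Q′* = Q′G′²Q′*` cancels one inverse). [cite: Balaban1984PropagatorsII, (2.17) p.225] -/
theorem pOp_mul_pOp {a msq : ℝ} (ha : 0 < a) (hm : 0 ≤ msq) (hK : 1 ≤ P.K) :
    pOp P a msq * pOp P a msq = pOp P a msq :=
  gscqg_idem ((tower P a msq).G P.K) (Qks P P.K) ((qggqK P a msq)⁻¹) (Qk P P.K) (cinvK_mul P ha hm hK)

/-- `Q_K*ᵀ = L^{Kd}·Q_K` (transpose of `Q_K = L^{−Kd}·Q_K*ᵀ`). [cite: Balaban1984PropagatorsI, (1.5) p.18; bookkeeping] -/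
theorem Qks_transpose : (Qks P P.K)ᵀ = (wQ P P.K)⁻¹ • Qk P P.K := by
  rw [Qk_eq_smul_transpose, smul_smul, inv_mul_cancel₀ (wQ_pos P P.K).ne', one_smul]

/-- `Q_Kᵀ = L^{−Kd}·Q_K*`. [cite: Balaban1984PropagatorsI, (1.5) p.18; bookkeeping] -/
theorem Qk_transpose : (Qk P P.K)ᵀ = wQ P P.K • Qks P P.K := by
  rw [Qk_eq_smul_transpose, Matrix.transpose_smul, Matrix.transpose_transpose]

/-- `((Q′G′²Q′*)⁻¹)ᵀ = (Q′G′²Q′*)⁻¹` (inverse of a symmetric matrix). [cite: Balaban1984PropagatorsII, p.235 («positive definite»); bookkeeping] -/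
theorem cinv_transpose {a msq : ℝ} (ha : 0 < a) (hm : 0 ≤ msq) (hK : 1 ≤ P.K) :
    ((qggqK P a msq)⁻¹)ᵀ = (qggqK P a msq)⁻¹ := by
  rw [Matrix.transpose_nonsing_inv, qggqK_transpose P ha hm hK]

/-- **`Pᵀ = P`**: `P` is a symmetric matrix, i.e. self-adjoint for the η-pairing `Σ_x η^d f(x)g(x)` (equal weights), so `R = I − P`
is an ORTHOGONAL projection (p. 225). [cite: Balaban1984PropagatorsII, p.225 («an orthogonal projection»), (2.17) p.225] -/
theorem pOp_transpose {a msq : ℝ} (ha : 0 < a) (hm : 0 ≤ msq) (hK : 1 ≤ P.K) : (pOp P a msq)ᵀ = pOp P a msq :=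
  gscqg_transpose ((tower P a msq).G P.K) (Qks P P.K) ((qggqK P a msq)⁻¹) (Qk P P.K) (wQ_pos P P.K).ne'
    (G_transpose P ha hm hK) (cinv_transpose P ha hm hK) (Qk_transpose P) (Qks_transpose P)

/-- `R² = R`. [cite: Balaban1984PropagatorsII, p.225 («an orthogonal projection»)] -/
theorem rOp_mul_rOp {a msq : ℝ} (ha : 0 < a) (hm : 0 ≤ msq) (hK : 1 ≤ P.K) :
    rOp P a msq * rOp P a msq = rOp P a msq := by
  unfold rOp
  rw [Matrix.sub_mul, Matrix.one_mul, Matrix.mul_sub, Matrix.mul_one, pOp_mul_pOp P ha hm hK, sub_self, sub_zero]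

/-- `Rᵀ = R`. [cite: Balaban1984PropagatorsII, p.225 («an orthogonal projection»)] -/
theorem rOp_transpose {a msq : ℝ} (ha : 0 < a) (hm : 0 ≤ msq) (hK : 1 ≤ P.K) : (rOp P a msq)ᵀ = rOp P a msq := by
  unfold rOp
  rw [Matrix.transpose_sub, Matrix.transpose_one, pOp_transpose P ha hm hK]

/-- The λ of p. 225 (the line before (2.17)): `λ = G′f − G′²Q′*(Q′G′²Q′*)⁻¹Q′G′f`. [cite: Balaban1984PropagatorsII, (2.16)–(2.17) p.225] -/
def lamOf (a msq : ℝ) (f : Site P 0 → ℝ) : Site P 0 → ℝ :=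
  (tower P a msq).G P.K *ᵥ f -
    ((tower P a msq).G P.K * (tower P a msq).G P.K * Qks P P.K * (qggqK P a msq)⁻¹ * Qk P P.K * (tower P a msq).G P.K) *ᵥ f

/-- *"Of course Q′λ = 0"* (p. 225): `λ = G′f − G′²Q′*(Q′G′²Q′*)⁻¹Q′G′f ∈ N(Q′_K)`. [cite: Balaban1984PropagatorsII, (2.16)–(2.17) p.225] -/
theorem Qk_lamOf {a msq : ℝ} (ha : 0 < a) (hm : 0 ≤ msq) (hK : 1 ≤ P.K) (f : Site P 0 → ℝ) :
    Qk P P.K *ᵥ lamOf P a msq f = 0 := by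
  rw [lamOf, Matrix.mulVec_sub, Matrix.mulVec_mulVec, Matrix.mulVec_mulVec,
    q_ggscqg ((tower P a msq).G P.K) (Qks P P.K) ((qggqK P a msq)⁻¹) (Qk P P.K) (mul_cinvK P ha hm hK), sub_self]

/-- **`Rf = Δ′_aλ`** with the λ above (p. 225: *"Rf = Δλ = Δ′_aλ = f − G′Q′\*(Q′G′²Q′\*)⁻¹Q′G′f. (2.17)"*; `Δ′G′ = 1`). [cite: Balaban1984PropagatorsII, (2.17) p.225] -/
theorem rOp_mulVec_eq {a msq : ℝ} (ha : 0 < a) (hm : 0 ≤ msq) (hK : 1 ≤ P.K) (f : Site P 0 → ℝ) :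
    rOp P a msq *ᵥ f = deltaPrimeK P a msq *ᵥ lamOf P a msq f := by
  rw [lamOf, Matrix.mulVec_sub, Matrix.mulVec_mulVec, Matrix.mulVec_mulVec, deltaPrimeK_mul_G P ha hm hK,
    d_ggscqg (deltaPrimeK P a msq) ((tower P a msq).G P.K) (Qks P P.K) ((qggqK P a msq)⁻¹) (Qk P P.K)
      (deltaPrimeK_mul_G P ha hm hK), rOp, pOp, Matrix.sub_mulVec, Matrix.one_mulVec]

/-- **`R` fixes `Δ′N(Q′_K)`**: `Q′λ = 0 ⟹ R(Δ′λ) = Δ′λ` (`G′Δ′ = 1`, then `Q′λ = 0` kills `P`).  With `rOp_mulVec_eq`, `rOp_mul_rOp`,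
`rOp_transpose`: `R = I − P` IS the orthogonal projection onto `Δ′_aN(Q′)` (= `ΔN(Q′)`, p. 225) — (2.17) for the genuine operators.
[cite: Balaban1984PropagatorsII, (2.17) p.225] -/
theorem rOp_mulVec_deltaPrime_of_ker {a msq : ℝ} (ha : 0 < a) (hm : 0 ≤ msq) (hK : 1 ≤ P.K) {lam : Site P 0 → ℝ}
    (hlam : Qk P P.K *ᵥ lam = 0) : rOp P a msq *ᵥ (deltaPrimeK P a msq *ᵥ lam) = deltaPrimeK P a msq *ᵥ lam := by
  rw [rOp, pOp, Matrix.mulVec_mulVec, Matrix.sub_mul, Matrix.one_mul,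
    gscqg_d (deltaPrimeK P a msq) ((tower P a msq).G P.K) (Qks P P.K) ((qggqK P a msq)⁻¹) (Qk P P.K)
      (G_mul_deltaPrimeK P ha hm hK), Matrix.sub_mulVec, ← Matrix.mulVec_mulVec, hlam, Matrix.mulVec_zero, sub_zero]

/-- `Q′G′R = 0` (the constraint `Q′λ = 0` of (2.16) transported: `Q′G′(I − P) = Q′G′ − (Q′G′²Q′*)(Q′G′²Q′*)⁻¹Q′G′ = 0`).
[cite: Balaban1984PropagatorsII, (2.16)–(2.17) p.225] -/
theorem Qk_G_rOp {a msq : ℝ} (ha : 0 < a) (hm : 0 ≤ msq) (hK : 1 ≤ P.K) :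
    Qk P P.K * (tower P a msq).G P.K * rOp P a msq = 0 := by
  rw [rOp, pOp, Matrix.mul_sub, Matrix.mul_one,
    qg_gscqg ((tower P a msq).G P.K) (Qks P P.K) ((qggqK P a msq)⁻¹) (Qk P P.K) (mul_cinvK P ha hm hK), sub_self]

/-! ## §2. The kernel of `∂_μP∂*_ν` and its factorisation through `𝔅` -/

/-- `1_{B^K(y₁)}` on the fine torus = `Q′*δ_{y₁}` (the test function *"λ = Q′\*δ_{y₁}"* of the reading of (2.88); the `y₁`-column of `Q_K*`).
[cite: Balaban1984PropagatorsII, (2.3)–(2.4) p.224, (2.88) p.238] -/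
def colB (y₁ : Site P P.K) : Site P 0 → ℝ := fun z => if blk P P.K z = y₁ then 1 else 0

/-- The matrix entry of `Q_K*` IS the block indicator: `Q_K*(z, y₁) = [z ∈ B^K(y₁)]`. [cite: Balaban1984PropagatorsI, (1.5)+(1.7) p.18; bookkeeping] -/
theorem Qks_apply (z : Site P 0) (y₁ : Site P P.K) : Qks P P.K z y₁ = colB P y₁ z := by
  show (if Site.proj P.K (lvl P P.K) z = y₁ then (1 : ℝ) else 0) = if blk P P.K z = y₁ then 1 else 0
  rw [lvl_of_le P (Nat.le_add_left _ _)]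
  rfl

/-- `∂_μG′` (forward η-derivative of `G′ = G′_K`). [cite: Balaban1984PropagatorsII, (2.67) p.234 (second quantity), (2.88) p.238] -/
def dG (a msq : ℝ) (μ : Fin P.d) : Matrix (Site P 0) (Site P 0) ℝ := deriv P 0 P.eps μ * (tower P a msq).G P.K

/-- `(∂_μG′Q′*)(x, y₁) = (∂_μG′1_{B(y₁)})(x)`: the matrix entry of `∂_μG′Q′*` is `∂_μG′` applied to the test function `Q′*δ_{y₁}`.
[cite: Balaban1984PropagatorsII, (2.88) p.238] -/
theorem dGQks_apply (a msq : ℝ) (μ : Fin P.d) (x : Site P 0) (y₁ : Site P P.K) :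
    (dG P a msq μ * Qks P P.K) x y₁ = (dG P a msq μ *ᵥ colB P y₁) x := by
  simp only [Matrix.mul_apply, Matrix.mulVec, dotProduct, Qks_apply]

/-- **The matrix `∂_μ·P·∂_νᵀ`** (`∂*_ν = ∂_νᵀ` for the η-pairing). [cite: Balaban1984PropagatorsII, (2.88) p.238] -/
def dPd (a msq : ℝ) (μ ν : Fin P.d) : Matrix (Site P 0) (Site P 0) ℝ :=
  deriv P 0 P.eps μ * pOp P a msq * (deriv P 0 P.eps ν)ᵀ

/-- **THE PRINTED KERNEL `(∂P∂*)_{μν}(x, x′)`** in the convention (2.150) (`(Af)(x) = Σ_{x′}η^dA(x, x′)f(x′)`): `η^{−d}` times the matrix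
entry of `∂_μP∂_νᵀ`. [cite: Balaban1984PropagatorsII, (2.88) p.238, (2.150) p.249] -/
def dPdKer (a msq : ℝ) (μ ν : Fin P.d) (x x' : Site P 0) : ℝ := (P.eps ^ P.d)⁻¹ * dPd P a msq μ ν x x'

/-- The kernel convention (2.150), checked: `(∂_μP∂*_νf)(x) = Σ_{x′} η^d·(∂P∂*)_{μν}(x, x′)·f(x′)`. [cite: Balaban1984PropagatorsII, (2.150) p.249] -/
theorem dPd_mulVec (a msq : ℝ) (μ ν : Fin P.d) (f : Site P 0 → ℝ) (x : Site P 0) :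
    (dPd P a msq μ ν *ᵥ f) x = ∑ x', P.eps ^ P.d * dPdKer P a msq μ ν x x' * f x' := by
  have hε : P.eps ^ P.d ≠ 0 := pow_ne_zero _ P.eps_pos.ne'
  simp only [Matrix.mulVec, dotProduct, dPdKer]
  refine Finset.sum_congr rfl fun x' _ => ?_
  rw [← mul_assoc, mul_inv_cancel₀ hε, one_mul]

/-- **`K₁`, the outer kernel of (2.88) at a fine point `x ∈ B^K(y)`**: `K₁ˣ(y, y₁) = (∂_μG′Q′*)(x, y₁)` (and `0` at labels `y` other than the
block of `x` — the kernel is indexed by `𝔅 × 𝔅` in the census decl `B6Cor28.Ineq288`). [cite: Balaban1984PropagatorsII, (2.88) p.238] -/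
def K1 (a msq : ℝ) (μ : Fin P.d) (x : Site P 0) : Site P P.K → Site P P.K → ℝ :=
  fun y y₁ => if blk P P.K x = y then (dG P a msq μ * Qks P P.K) x y₁ else 0

/-- **`K₃`, the outer kernel at `x′ ∈ B^K(y′)` read from the far end** (*"(Q′G′∂\*_ν)(y₂, x′)"* = `(∂_νG′Q′*)(x′, y₂)` by the symmetry of
`G′`; the print's third factor `e^{−½δ₀d(y₂,y′)}L^{j′}η` carries the prefactor of the `x′`-end — one of the *"admissible choices"*).
[cite: Balaban1984PropagatorsII, (2.88) p.238] -/
def K3 (a msq : ℝ) (ν : Fin P.d) (x' : Site P 0) : Site P P.K → Site P P.K → ℝ :=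
  fun y₂ y' => if blk P P.K x' = y' then (dG P a msq ν * Qks P P.K) x' y₂ else 0

/-- `L^{−Kd} = η^d` (`η = L^{−K}`). [cite: Balaban1984PropagatorsII, (2.14) p.225; bookkeeping] -/
theorem wQ_eq_eps_pow : wQ P P.K = P.eps ^ P.d := by
  unfold wQ Params.eps
  rw [lvl_of_le P (Nat.le_add_left _ _), ← inv_pow, ← pow_mul, ← pow_mul, mul_comm]

/-- `Q′G′∂*_ν = η^d·(∂_νG′Q′*)ᵀ` (`Q_K = η^d·Q_K*ᵀ`, `G′ᵀ = G′`). [cite: Balaban1984PropagatorsII, (2.88) p.238; bookkeeping] -/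
theorem Qk_G_derivT_eq {a msq : ℝ} (ha : 0 < a) (hm : 0 ≤ msq) (hK : 1 ≤ P.K) (ν : Fin P.d) :
    Qk P P.K * (tower P a msq).G P.K * (deriv P 0 P.eps ν)ᵀ = wQ P P.K • (dG P a msq ν * Qks P P.K)ᵀ := by
  rw [dG, Matrix.transpose_mul, Matrix.transpose_mul, G_transpose P ha hm hK, Qk_eq_smul_transpose, Matrix.smul_mul,
    Matrix.smul_mul, Matrix.mul_assoc]

/-- the matrix entry of `∂_μP∂_νᵀ` as the `𝔅 × 𝔅` double sum, with the weight `η^d`. [cite: Balaban1984PropagatorsII, (2.88) p.238] -/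
theorem dPd_apply {a msq : ℝ} (ha : 0 < a) (hm : 0 ≤ msq) (hK : 1 ≤ P.K) (μ ν : Fin P.d) (x x' : Site P 0) :
    dPd P a msq μ ν x x' =
      wQ P P.K * ∑ y₁, ∑ y₂, (dG P a msq μ * Qks P P.K) x y₁ * (qggqK P a msq)⁻¹ y₁ y₂ * (dG P a msq ν * Qks P P.K) x' y₂ := by
  have h1 : dPd P a msq μ ν =
      (dG P a msq μ * Qks P P.K) * (qggqK P a msq)⁻¹ * (Qk P P.K * (tower P a msq).G P.K * (deriv P 0 P.eps ν)ᵀ) := by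
    simp only [dPd, pOp, dG, Matrix.mul_assoc]
  rw [h1, Qk_G_derivT_eq P ha hm hK, Matrix.mul_smul, Matrix.smul_apply, smul_eq_mul]
  congr 1
  generalize dG P a msq μ * Qks P P.K = A
  generalize dG P a msq ν * Qks P P.K = B
  simp only [Matrix.mul_apply, Matrix.transpose_apply, Finset.sum_mul]
  rw [Finset.sum_comm]

/-- **THE PRINTED FACTORISATION, EXACT**: `(∂P∂*)_{μν}(x, x′) = Σ_{y₁,y₂∈𝔅}(∂_μG′Q′*)(x, y₁)·(Q′G′²Q′*)⁻¹(y₁, y₂)·(Q′G′∂*_ν)(y₂, x′)` — the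
printed kernel of `∂_μP∂*_ν` at `(x, x′)`, `x ∈ B^K(y)`, `x′ ∈ B^K(y′)`, IS the plain three-fold composition `B6Cor28.comp3` of the outer kernels
`K₁ˣ`, `K₃ˣ′` with `(Q′G′²Q′*)⁻¹` evaluated at `(y, y′)` (on one scale the pairing weights `(L^{j₁}η)^d(L^{j₂}η)^d` of (2.69) are 1; the
fine weight `η^d` of `Q′` cancels the `η^{−d}` of the kernel convention). [cite: Balaban1984PropagatorsII, (2.88) p.238] -/
theorem dPdKer_eq_comp3 {a msq : ℝ} (ha : 0 < a) (hm : 0 ≤ msq) (hK : 1 ≤ P.K) (μ ν : Fin P.d) (x x' : Site P 0) :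
    dPdKer P a msq μ ν x x' =
      comp3 (K1 P a msq μ x) (fun y y' => (qggqK P a msq)⁻¹ y y') (K3 P a msq ν x') (blk P P.K x) (blk P P.K x') := by
  have hε : P.eps ^ P.d ≠ 0 := pow_ne_zero _ P.eps_pos.ne'
  rw [dPdKer, dPd_apply P ha hm hK, wQ_eq_eps_pow, ← mul_assoc, inv_mul_cancel₀ hε, one_mul, comp3]
  simp only [K1, K3, if_true]

/-! ## §3. The reading of (2.88) DISCHARGED: the outer kernels are dominated by entry 1 of the genuine (2.67)-family -/

/-- The vector test function *"λ = Q′\*δ_{y₁}"*: every component the block indicator `1_{B^K(y₁)}`. [cite: Balaban1984PropagatorsII, (2.88) p.238] -/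
def lamB (y₁ : Site P P.K) : Fin P.d → Site P 0 → ℝ := fun _ => colB P y₁

/-- `supp λ ⊂ B^K(y₁)` (hypothesis `hsupp` of the edge). [cite: Balaban1984PropagatorsII, (2.67) p.234 («supp λ ⊂ B^{j′}(y′)»)] -/
theorem lamB_supp (Mb R : ℕ) (y₁ : Site P P.K) : (oneScaleGeo P Mb R).suppIn (lamB P y₁) y₁ := by
  intro ν x hx
  by_contra h
  exact hx (if_neg h)

/-- `|λ| ≤ 1` (`c_Q = 1`; hypothesis `hnorm`). [cite: Balaban1984PropagatorsII, (2.3)–(2.4) p.224; Balaban1984PropagatorsI, (1.108) p.35] -/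
theorem supNormV_lamB_le (y₁ : Site P P.K) : supNormV P (lamB P y₁) ≤ 1 := by
  unfold supNormV
  refine Finset.sup'_le _ _ fun ν _ => ?_
  unfold supN
  refine Finset.sup'_le _ _ fun x _ => ?_
  show |(if blk P P.K x = y₁ then (1 : ℝ) else 0)| ≤ 1
  split_ifs <;> simp

/-- a block sup is non-negative. [cite: Balaban1984PropagatorsII, (2.67) p.234; bookkeeping] -/
theorem blockSup_nonneg {k : ℕ} (y : Site P k) {ι : Type} [Fintype ι] (i₀ : ι) (g : ι → Site P 0 → ℝ) :
    0 ≤ blockSup P k y i₀ g := by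
  unfold blockSup
  refine Finset.le_sup'_of_le (fun p : Site P 0 × ι => if blk P k p.1 = y then |g p.2 p.1| else 0)
    (Finset.mem_univ ((default : Site P 0), i₀)) ?_
  show (0 : ℝ) ≤ if blk P k (default : Site P 0) = y then |g i₀ default| else 0
  split_ifs
  · exact abs_nonneg _
  · exact le_rfl

/-- **THE READING OF THE FIRST FACTOR, DISCHARGED**: `|(∂_μG′Q′*)(x, y₁)| ≤ sup_{x∈B^K(y)} max_{μ′,ν′}|(∂_{μ′}G′λ_{ν′})(x)|` with `λ = Q′\*δ_{y₁}`
— the outer kernel `K₁ˣ(y, y₁)` IS dominated by entry 1 of (2.67) (`∇G′`, prefactor `L^jη`) of the genuine family `torusGp` (hypothesis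
`hval₁` of `B6Ineq288Edge.ineq288_of_printed`). [cite: Balaban1984PropagatorsII, (2.88) p.238 («from … Proposition 2.2»), (2.67) p.234] -/
theorem abs_K1_le (a msq : ℝ) (Mb R : ℕ) (μ : Fin P.d) (x : Site P 0) (y y₁ : Site P P.K) :
    |K1 P a msq μ x y y₁| ≤ (torusGp P a msq Mb R).e 1 (lamB P y₁) y := by
  show |K1 P a msq μ x y y₁| ≤ entryB P a msq P.K 1 (lamB P y₁) y
  rw [entryB_one_top]
  simp only [K1]
  split_ifs with h
  · rw [dGQks_apply]
    exact le_blockSup (dir0 P, dir0 P)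
      (fun p : Fin P.d × Fin P.d => fun x => ((deriv P 0 P.eps p.1 * (tower P a msq).G P.K) *ᵥ lamB P y₁ p.2) x) (μ, dir0 P) h
  · rw [abs_zero]
    exact blockSup_nonneg P y _ _

/-- **THE READING OF THE THIRD FACTOR, DISCHARGED** (read from the far end): `|(Q′G′∂*_ν)(y₂, x′)| = |(∂_νG′Q′\*δ_{y₂})(x′)| ≤` entry 1 of
(2.67) with the test function at `y₂`, evaluated over `B^K(y′) ∋ x′` (hypothesis `hval₃`). [cite: Balaban1984PropagatorsII, (2.88) p.238, (2.67) p.234] -/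
theorem abs_K3_le (a msq : ℝ) (Mb R : ℕ) (ν : Fin P.d) (x' : Site P 0) (y₂ y' : Site P P.K) :
    |K3 P a msq ν x' y₂ y'| ≤ (torusGp P a msq Mb R).e 1 (lamB P y₂) y' := by
  show |K3 P a msq ν x' y₂ y'| ≤ entryB P a msq P.K 1 (lamB P y₂) y'
  rw [entryB_one_top]
  simp only [K3]
  split_ifs with h
  · rw [dGQks_apply]
    exact le_blockSup (dir0 P, dir0 P)
      (fun p : Fin P.d × Fin P.d => fun x => ((deriv P 0 P.eps p.1 * (tower P a msq).G P.K) *ᵥ lamB P y₂ p.2) x) (ν, dir0 P) h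
  · rw [abs_zero]
    exact blockSup_nonneg P y' _ _

/-! ## §4. (2.88) on the one-scale tower-torus family -/

/-- largeness bookkeeping: `1 ≤ L`, `0 ≤ q`, `q·log L ≤ t ⟹ L^q ≤ e^t`. [cite: Balaban1984PropagatorsII, (2.59) p.233; bookkeeping] -/
theorem rpow_le_exp_of_mul_log_le {L q t : ℝ} (hL : 1 ≤ L) (h : q * Real.log L ≤ t) : L ^ q ≤ Real.exp t := by
  have hL0 : 0 < L := lt_of_lt_of_le one_pos hL
  rw [Real.rpow_def_of_pos hL0, mul_comm]
  exact Real.exp_le_exp.mpr h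

variable {P} in
/-- the three largeness conditions `L⁴, L^d, L¹ ≤ e^{αδRM}` of the edge hold at `α = ½` as soon as `R ≥ 1` and `M ≥ 2(d+4)log L/δ` (`δ > 0`).
[cite: Balaban1984PropagatorsII, (2.59) p.233 («we require that RM is sufficiently large»); bookkeeping] -/
theorem largeness_of_threshold {d : ℕ} {L δ R M : ℝ} (hL : 1 ≤ L) (hδ : 0 < δ) (hR : 1 ≤ R) (hM0 : 0 ≤ M)
    (hM : 2 * ((d : ℝ) + 4) * Real.log L / δ ≤ M) :
    L ^ (4 : ℝ) ≤ Real.exp (1 / 2 * δ * R * M) ∧ L ^ (d : ℝ) ≤ Real.exp (1 / 2 * δ * R * M) ∧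
      L ^ (1 : ℝ) ≤ Real.exp (1 / 2 * δ * R * M) := by
  have hlog : 0 ≤ Real.log L := Real.log_nonneg hL
  have hRM : M ≤ R * M := le_mul_of_one_le_left hM0 hR
  have hkey : ((d : ℝ) + 4) * Real.log L ≤ 1 / 2 * δ * R * M := by
    have h1 : 2 * ((d : ℝ) + 4) * Real.log L ≤ δ * M := by
      have := (div_le_iff₀ hδ).mp hM; linarith
    nlinarith [mul_le_mul_of_nonneg_left hRM hδ.le]
  have hd0 : (0 : ℝ) ≤ d := Nat.cast_nonneg d
  refine ⟨rpow_le_exp_of_mul_log_le hL ?_, rpow_le_exp_of_mul_log_le hL ?_, rpow_le_exp_of_mul_log_le hL ?_⟩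
  · nlinarith
  · nlinarith
  · nlinarith

/-- **`B6Cor28.Ineq288` INHABITED FOR THE GENUINE KERNELS** `(K₁ˣ, (Q′G′²Q′*)⁻¹, K₃ˣ′)` on the one-scale tower-torus family: for `d ≥ 1`, odd
`L > 1`, `a > 0`, `m² ≥ 0` there are `M₂, C, δ₂ > 0` such that for EVERY member (`Index d L`: every volume, every `K ≥ 1`) with `R ≥ 1`
and `Mb ≥ M₂`, all `μ, ν` and all fine points `x, x′`: `|Σ_{y₁,y₂}K₁ˣ(y, y₁)(Q′G′²Q′*)⁻¹(y₁, y₂)K₃ˣ′(y₂, y′)| ≤ C(L^jη)^{−2}(L^{j′}η)^{−d}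
e^{−δ₂d(y,y′)}` for all `y, y′ ∈ 𝔅` — the census edge `B6Ineq288Edge.ineq288_of_printed` (Prop. 2.2 ∧ Prop. 2.3 ∧ (2.54) ∧ (2.60)–(2.61)
⟹ (2.88)) applied BY NAME to `prop22Printed_oneScaleTorus`, `prop23Printed_towerTorus`, the discharged reading (§3, `c_Q = 1`, entries
`n₁ = n₃ = 1`), `α = ½`, `δ = min(δ₀, δ₁)/4`, `c_L = c₁(δ, ½)` (printed), the largeness exhibited.
[cite: Balaban1984PropagatorsII, (2.88) p.238] -/
theorem ineq288_read_towerTorus (d L : ℕ) (hd : 1 ≤ d) (hL : Odd L ∧ 1 < L) {a : ℝ} (ha : 0 < a) {msq : ℝ} (hmsq : 0 ≤ msq) :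
    ∃ M₂ C δ₂ : ℝ, 0 < M₂ ∧ 0 < C ∧ 0 < δ₂ ∧ ∀ i : Index d L, 1 ≤ i.R → M₂ ≤ (i.Mb : ℝ) →
      ∀ (μ ν : Fin i.P.d) (x x' : Site i.P 0),
        Ineq288 (oneScaleGeo i.P i.Mb i.R) d (K1 i.P a msq μ x) (cinvK i.P a msq i.Mb i.R).ker (K3 i.P a msq ν x') C δ₂ := by
  obtain ⟨M₂, δ₀, δ₁, C', C'', hM₂, hδ₀, hδ₁, hC', hC'', hall⟩ :=
    B6Ineq288Edge.ineq288_of_printed d (fun i : Index d L => oneScaleGeo i.P i.Mb i.R) (fun i => torusGp i.P a msq i.Mb i.R)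
      (fun i => cinvK i.P a msq i.Mb i.R) (prop22Printed_oneScaleTorus d L hd hL ha hmsq) (prop23Printed_towerTorus d L hd hL ha hmsq)
  -- the rate δ = min(δ₀, δ₁)/4 (compatible with the printed rates at α = ½) and the constants
  obtain ⟨δ, hδ_def⟩ : ∃ δ : ℝ, δ = min δ₀ δ₁ / 4 := ⟨_, rfl⟩
  have hδ : 0 < δ := by rw [hδ_def]; exact div_pos (lt_min hδ₀ hδ₁) four_pos
  have hδa : δ + 2 * (1 / 2 * δ) ≤ δ₀ / 2 := by
    have : min δ₀ δ₁ ≤ δ₀ := min_le_left _ _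
    rw [hδ_def]; linarith
  have hδb : δ + 1 / 2 * δ ≤ δ₁ / 2 := by
    have : min δ₀ δ₁ ≤ δ₁ := min_le_right _ _
    rw [hδ_def]; linarith
  have hL1 : (1 : ℝ) ≤ (L : ℝ) := by exact_mod_cast hL.2.le
  have hcL : 0 ≤ B6.c1 d δ (1 / 2) := B6RandomWalk.c1_nonneg d δ (1 / 2)
  have hC0 : 0 ≤ C' * C'' * C' * (L : ℝ) ^ (4 : ℝ) * (L : ℝ) ^ (d : ℝ) * (L : ℝ) ^ (1 : ℝ) * B6.c1 d δ (1 / 2) ^ 3 := by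
    positivity
  refine ⟨max M₂ (max 1 (2 * ((d : ℝ) + 4) * Real.log L / δ)),
    C' * C'' * C' * (L : ℝ) ^ (4 : ℝ) * (L : ℝ) ^ (d : ℝ) * (L : ℝ) ^ (1 : ℝ) * B6.c1 d δ (1 / 2) ^ 3 + 1, δ / 2,
    lt_of_lt_of_le hM₂ (le_max_left _ _), by linarith, by linarith, ?_⟩
  intro i hR hM μ ν x x'
  -- the member's data and the largeness conditions
  have hPL : ((i.P.L : ℕ) : ℝ) = (L : ℝ) := by exact_mod_cast i.hPL
  have hM₂i : M₂ ≤ (i.Mb : ℝ) := le_trans (le_max_left _ _) hM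
  have hTi : 2 * ((d : ℝ) + 4) * Real.log L / δ ≤ (i.Mb : ℝ) := le_trans (le_trans (le_max_right _ _) (le_max_right _ _)) hM
  have hRi : (1 : ℝ) ≤ (i.R : ℝ) := by exact_mod_cast hR
  have hMb0 : (0 : ℝ) ≤ (i.Mb : ℝ) := Nat.cast_nonneg _
  obtain ⟨hl4, hld, hl1⟩ := largeness_of_threshold (d := d) hL1 hδ hRi hMb0 hTi
  have h260 : Ineq260 (oneScaleGeo i.P i.Mb i.R) δ (1 / 2) :=
    ineq260_oneScaleGeo i.P i.Mb i.R (mul_nonneg (by norm_num) hδ.le)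
  have h261 : Ineq261With (B6.c1 d δ (1 / 2)) (oneScaleGeo i.P i.Mb i.R) δ (1 / 2) :=
    ineq261_oneScaleGeo i.P i.hPd i.Mb i.R (mul_pos (by norm_num) hδ)
  have key := hall i trivial hM₂i (triangle254_oneScaleGeo i.P i.Mb i.R) (fun y y' => T1_nonneg i.P i.P.K y y')
    (dist_symm_oneScaleGeo i.P i.Mb i.R) (by show (1 : ℝ) ≤ ((i.P.L : ℕ) : ℝ); rw [hPL]; exact hL1) i.P.eps_pos 1 1
    B6Ineq288Edge.pref4_one B6Ineq288Edge.pref4_one (K1 i.P a msq μ x) (K3 i.P a msq ν x') (lamB i.P) (lamB i.P) 1 zero_le_one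
    (fun y₁ => lamB_supp i.P i.Mb i.R y₁) (fun y₁ => supNormV_lamB_le i.P y₁) (fun y₂ => lamB_supp i.P i.Mb i.R y₂)
    (fun y₂ => supNormV_lamB_le i.P y₂) (fun y y₁ => abs_K1_le i.P a msq i.Mb i.R μ x y y₁)
    (fun y₂ y' => abs_K3_le i.P a msq i.Mb i.R ν x' y₂ y') δ (1 / 2) (B6.c1 d δ (1 / 2)) hδ.le (by norm_num) (by norm_num)
    hδa hδb h260 h261
    (by show ((i.P.L : ℕ) : ℝ) ^ (4 : ℝ) ≤ Real.exp (1 / 2 * δ * (i.R : ℝ) * (i.Mb : ℝ)); rw [hPL]; exact hl4)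
    (by show ((i.P.L : ℕ) : ℝ) ^ (d : ℝ) ≤ Real.exp (1 / 2 * δ * (i.R : ℝ) * (i.Mb : ℝ)); rw [hPL]; exact hld)
    (by show ((i.P.L : ℕ) : ℝ) ^ (1 : ℝ) ≤ Real.exp (1 / 2 * δ * (i.R : ℝ) * (i.Mb : ℝ)); rw [hPL]; exact hl1)
  -- unpack the edge's conclusion at (y, y′): prefactors are 1 on one scale; the edge's constant is this file's constant minus 1
  intro y y'
  have hk := key y y'
  have hhalf : (1 - 1 / 2 : ℝ) * δ = δ / 2 := by ring
  simp only [oneScaleGeo_len, Real.one_rpow, mul_one, hhalf] at hk ⊢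
  rw [hPL] at hk
  have hE : 0 ≤ Real.exp (-(δ / 2 * (oneScaleGeo i.P i.Mb i.R).dist y y')) := (Real.exp_pos _).le
  calc |comp3 (K1 i.P a msq μ x) (cinvK i.P a msq i.Mb i.R).ker (K3 i.P a msq ν x') y y'|
      ≤ C' * C'' * C' * (L : ℝ) ^ (4 : ℝ) * (L : ℝ) ^ (d : ℝ) * (L : ℝ) ^ (1 : ℝ) * B6.c1 d δ (1 / 2) ^ 3 *
          Real.exp (-(δ / 2 * (oneScaleGeo i.P i.Mb i.R).dist y y')) := hk
    _ ≤ (C' * C'' * C' * (L : ℝ) ^ (4 : ℝ) * (L : ℝ) ^ (d : ℝ) * (L : ℝ) ^ (1 : ℝ) * B6.c1 d δ (1 / 2) ^ 3 + 1) *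
          Real.exp (-(δ / 2 * (oneScaleGeo i.P i.Mb i.R).dist y y')) :=
        mul_le_mul_of_nonneg_right (by linarith) hE

/-- **(2.88) ON THE ONE-SCALE TOWER-TORUS FAMILY FOR THE GENUINE KERNEL OF `∂P∂*`** (`P = G′Q′*(Q′G′²Q′*)⁻¹Q′G′` of (2.17), `G′ = Δ′_a⁻¹ =
(−Δ^η + m² + a_KQ′_K\*Q′_K)⁻¹`, `∂_μ = ∂^η_μ`, `∂*_ν` its η-adjoint): for `d ≥ 1`, odd `L > 1`, `a > 0`, `m² ≥ 0` there are `M₂, C, δ₂ > 0` with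
`|(∂P∂*)_{μν}(x, x′)| ≤ C·e^{−δ₂d(y,y′)}`, `x ∈ B^K(y)`, `x′ ∈ B^K(y′)`, all `μ, ν`, for EVERY member with `R ≥ 1`, `Mb ≥ M₂` — every volume, every
`K ≥ 1` (mesh `η = L^{−K}` arbitrarily small), constants uniform; `(L^jη)^{−2}(L^{j′}η)^{−d} = 1` on one scale.  = `ineq288_read_towerTorus` at
`(y, y′) = (y(x), y(x′))` through the exact factorisation `dPdKer_eq_comp3`. [cite: Balaban1984PropagatorsII, (2.88) p.238] -/
theorem ineq288_towerTorus (d L : ℕ) (hd : 1 ≤ d) (hL : Odd L ∧ 1 < L) {a : ℝ} (ha : 0 < a) {msq : ℝ} (hmsq : 0 ≤ msq) :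
    ∃ M₂ C δ₂ : ℝ, 0 < M₂ ∧ 0 < C ∧ 0 < δ₂ ∧ ∀ i : Index d L, 1 ≤ i.R → M₂ ≤ (i.Mb : ℝ) →
      ∀ (μ ν : Fin i.P.d) (x x' : Site i.P 0),
        |dPdKer i.P a msq μ ν x x'| ≤ C * Real.exp (-(δ₂ * T1 i.P i.P.K (blk i.P i.P.K x) (blk i.P i.P.K x'))) := by
  obtain ⟨M₂, C, δ₂, hM₂, hC, hδ₂, h⟩ := ineq288_read_towerTorus d L hd hL ha hmsq
  refine ⟨M₂, C, δ₂, hM₂, hC, hδ₂, fun i hR hM μ ν x x' => ?_⟩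
  have hk := h i hR hM μ ν x x' (blk i.P i.P.K x) (blk i.P i.P.K x')
  rw [oneScaleGeo_len, oneScaleGeo_len, Real.one_rpow, Real.one_rpow, mul_one, mul_one] at hk
  rw [dPdKer_eq_comp3 i.P ha hmsq i.hK]
  exact hk

/-- **Non-vacuity of the thresholds**: for every `d ≥ 1`, odd `L > 1`, every volume exponent `m`, scale `K ≥ 1` and every `M₂` the family has
a member with these `m, K`, with `R = 1 ≥ 1` and `Mb ≥ M₂`; it meets (2.1)–(2.2) (void on one scale) — so `ineq288_towerTorus` asserts (2.88)
for members of every volume and mesh, not vacuously. [cite: Balaban1984PropagatorsII, (2.88) p.238; Prop. 2.2 p.234 («M sufficiently large»)] -/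
theorem towerTorus_meets_thresholds (d L : ℕ) (hd : 1 ≤ d) (hL : Odd L ∧ 1 < L) (m K : ℕ) (hK : 1 ≤ K) (M₂ : ℝ) :
    ∃ i : Index d L, i.P.m = m ∧ i.P.K = K ∧ 1 ≤ i.R ∧ M₂ ≤ (i.Mb : ℝ) ∧ (oneScaleGeo i.P i.Mb i.R).Hyp21_22 :=
  ⟨⟨⟨⟨d, L, m, K, hd, hL⟩, rfl, rfl, hK⟩, ⌈M₂⌉₊, 1⟩, rfl, rfl, le_rfl, Nat.le_ceil M₂, trivial⟩

end

end Literature.MathematicalPhysics.QuantumFieldTheory.Balaban1983to89.B6Ineq288OneScaleTorus
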